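import Mathlib.Probability.Moments.Variance
import Literature.Probability.Percolation.UniquenessInfiniteCluster
import HarnessLib

/-!
# The density bound `θ² ≤ |B|⁻² ∑_{x,y∈B} μ[x ↔ y]` under uniqueness of the infinite cluster

Topic `Literature/Probability/Percolation`, namespace `Literature.StatMech`. The percolation skeleton of

* M. Aizenman, H. Duminil-Copin, V. Sidoravicius, *Random currents and continuity of Ising
  model's spontaneous magnetization*, Comm. Math. Phys. **334** (2015) 719–742, proof of Thm. 3.1,
  eqs. (3.4)–(3.5) (arXiv:1311.1937v3 numbering; bib key `AizenmanDuminilCopinSidoraviciusCMP2015`):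
  "The Cauchy–Schwarz inequality applied to the random variable `X = ∑_{x∈B} 𝟙{x ↔ ∞}` leads to
  `(|B| ℙ[0 ↔ ∞])² := 𝔼[X]² ≤ 𝔼[X²] =: ∑_{x,y∈B} ℙ[x,y ↔ ∞]`. The uniqueness of the infinite
  cluster thus implies `(|B| ℙ[0 ↔ ∞])² ≤ ∑_{x,y∈B} ℙ[x,y ↔ ∞] ≤ ∑_{x,y∈B} ℙ[x ↔ y]`",
  and Remark 3.2: "one can see uniqueness of the infinite cluster used as a substitute for the
  classical percolation argument which utilizes the FKG inequality, which we do not have for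
  random currents",

for an **arbitrary** probability measure `μ` on bond configurations of `ℤ^d` (no FKG, no
independence): if `μ` is invariant under lattice translations and `μ`-a.s. there is at most one
infinite open cluster, then for every nonempty finite `B ⊆ ℤ^d`

  `μ[0 ↔ ∞]² ≤ |B|⁻² ∑_{x,y ∈ B} μ[x ↔ y]`   (`sq_measureReal_percolatesAt_le`).

Combined with the tree's Burton–Keane theorem for invariant, ergodic, insertion-tolerant measures
(`numInfiniteClusters_le_one_of_invariant`, `UniquenessInfiniteClusterGeneral.lean`) and an upper
bound `μ[x ↔ y] ≤ τ(x,y)` (for the ADS double current: `⟨σ_xσ_y⟩⁰_β`, eq. (3.3)), this is ADS15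
Thm. 3.1: `μ[0 ↔ ∞]² ≤ inf_B |B|⁻² ∑_{x,y∈B} τ(x,y)` (`sq_measureReal_percolatesAt_le_of_le`).

**A variant without ergodicity.** Uniqueness is used only through "the percolating sites of `B`
fall into one class of mutually connected sites"; with at most *two* infinite clusters they fall
into at most two classes and `(a+b)² ≤ 2(a²+b²)` still gives
`μ[0 ↔ ∞]² ≤ 2|B|⁻² ∑_{x,y∈B} μ[x ↔ y]` (`card_filter_percolatesAt_sq_le`,
`sq_measureReal_percolatesAt_le_two_mul`, `measure_percolatesAt_eq_zero_of_forall_exists'`). Since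
"no three infinite clusters" is the half of Burton–Keane that needs only translation invariance and
insertion tolerance (`measure_threeInfClusters_eq_zero_of_invariant`, the proof of the tree's
`IsInsertionTolerantErgodic.threeInfClusters_eq_zero` with the hypotheses it uses), the conclusion
of ADS15 Thm. 3.1 (`M̃_LRO = 0 ⇒ μ[x ↔ ∞] = 0`) holds for translation-invariant insertion-tolerant
limits without the ergodicity (R3) of ADS15 Thm. 2.3 — i.e. without the mixing of Appendix A
(`measure_percolatesAt_eq_zero_of_insertionTolerant`).

## Mathlib status

Anchors: `ProbabilityTheory.variance_nonneg`, `ProbabilityTheory.variance_eq_sub`, `MemLp.of_bound`,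
`integral_finset_sum`, `integral_indicator_one`; tree: `percolatesAt`, `openConn`,
`numInfiniteClusters_le_one_iff`, `relabel_mem_percolatesAt_iff`, `measurableSet_openConn_holds`,
`measurableSet_percolatesAt_holds`, `BondConfig.relabel`, `sym2Equiv`, `Site.shift`.
-/

noncomputable section

namespace Literature.Probability.Percolation

open MeasureTheory ProbabilityTheory SimpleGraph Finset
open Percolation (shiftedBox mem_shiftedBox_iff shiftedBox_zero)
open scoped ENNReal

variable {V : Type*}

/-! ### Two infinite clusters through `x` and `y` coincide under uniqueness -/

/-- Under `N ≤ 1`, `{x ↔ ∞} ∩ {y ↔ ∞} ⊆ {x ↔ y}` (Aizenman–Duminil-Copin–Sidoravicius 2015, proof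
of Thm. 3.1, (3.4): "The uniqueness of the infinite cluster thus implies
`ℙ[x,y ↔ ∞] ≤ ℙ[x ↔ y]`"). [cite: AizenmanDuminilCopinSidoraviciusCMP2015, proof of Thm. 3.1, eq. (3.4)] -/
theorem percolatesAt_inter_percolatesAt_subset_openConn_union (x y : V) :
    (percolatesAt x ∩ percolatesAt y : Set (BondConfig V)) ⊆
      openConn x y ∪ {ω | ¬ numInfiniteClusters ω ≤ 1} := by
  intro ω ⟨hx, hy⟩
  by_cases h : numInfiniteClusters ω ≤ 1
  · exact Or.inl ((numInfiniteClusters_le_one_iff ω).1 h x y hx hy)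
  · exact Or.inr h

/-- Hence `μ[x ↔ ∞, y ↔ ∞] ≤ μ[x ↔ y]` when `μ`-a.s. there is at most one infinite cluster. [cite: AizenmanDuminilCopinSidoraviciusCMP2015, proof of Thm. 3.1, eq. (3.4)] -/
theorem measureReal_percolatesAt_inter_le (μ : Measure (BondConfig V)) [IsFiniteMeasure μ]
    (huniq : ∀ᵐ ω ∂μ, numInfiniteClusters ω ≤ 1) (x y : V) :
    μ.real (percolatesAt x ∩ percolatesAt y) ≤ μ.real (openConn x y) := by
  have h0 : μ {ω | ¬ numInfiniteClusters ω ≤ 1} = 0 := ae_iff.1 huniq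
  calc μ.real (percolatesAt x ∩ percolatesAt y)
      ≤ μ.real (openConn x y ∪ {ω | ¬ numInfiniteClusters ω ≤ 1}) :=
        measureReal_mono (percolatesAt_inter_percolatesAt_subset_openConn_union x y)
    _ ≤ μ.real (openConn x y) + μ.real {ω | ¬ numInfiniteClusters ω ≤ 1} := measureReal_union_le _ _
    _ = μ.real (openConn x y) := by
        have : μ.real {ω | ¬ numInfiniteClusters ω ≤ 1} = 0 := by
          rw [measureReal_def, h0, ENNReal.toReal_zero]
        rw [this, add_zero]

/-! ### Cauchy–Schwarz for the number of percolating sites of `B` -/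

/-- **Second-moment bound** (Aizenman–Duminil-Copin–Sidoravicius 2015, proof of Thm. 3.1:
`𝔼[X]² ≤ 𝔼[X²]` for `X = ∑_{x∈B} 𝟙{x ↔ ∞}`): for a probability measure `μ` and a finite `B`,
`(∑_{x∈B} μ[x ↔ ∞])² ≤ ∑_{x,y∈B} μ[x ↔ ∞, y ↔ ∞]`. [cite: AizenmanDuminilCopinSidoraviciusCMP2015, proof of Thm. 3.1] -/
theorem sq_sum_measureReal_percolatesAt_le [Countable V] (μ : Measure (BondConfig V))
    [IsProbabilityMeasure μ] (B : Finset V) :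
    (∑ x ∈ B, μ.real (percolatesAt x)) ^ 2 ≤
      ∑ x ∈ B, ∑ y ∈ B, μ.real (percolatesAt x ∩ percolatesAt y) := by
  classical
  have hmeas : ∀ x : V, MeasurableSet (percolatesAt x : Set (BondConfig V)) := fun x =>
    measurableSet_percolatesAt_holds x
  -- the random variable `X = ∑_{x∈B} 𝟙{x ↔ ∞}`
  set X : BondConfig V → ℝ := fun ω => ∑ x ∈ B, (percolatesAt x).indicator 1 ω with hX
  have hXmeas : Measurable X :=
    Finset.measurable_sum _ fun x _ => measurable_one.indicator (hmeas x)
  have hXbdd : ∀ ω, ‖X ω‖ ≤ (B.card : ℝ) := by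
    intro ω
    have h1 : 0 ≤ X ω := Finset.sum_nonneg fun x _ => Set.indicator_nonneg (fun _ _ => zero_le_one) _
    rw [Real.norm_eq_abs, abs_of_nonneg h1, hX]
    calc ∑ x ∈ B, (percolatesAt x).indicator (1 : BondConfig V → ℝ) ω ≤ ∑ _x ∈ B, (1 : ℝ) :=
          Finset.sum_le_sum fun x _ => Set.indicator_apply_le' (fun _ => le_rfl) (fun _ => zero_le_one)
      _ = B.card := by simp
  have hLp : MemLp X 2 μ := MemLp.of_bound hXmeas.aestronglyMeasurable _ (Filter.Eventually.of_forall hXbdd)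
  -- `E[X]` and `E[X²]`
  have hEX : μ[X] = ∑ x ∈ B, μ.real (percolatesAt x) := by
    have h := integral_finsetSum B (μ := μ)
      (f := fun x (ω : BondConfig V) => (percolatesAt x).indicator (1 : BondConfig V → ℝ) ω)
      fun x _ => (integrable_const (1 : ℝ)).indicator (hmeas x)
    rw [show μ[X] = ∫ ω, ∑ x ∈ B, (percolatesAt x).indicator (1 : BondConfig V → ℝ) ω ∂μ from rfl, h]
    refine Finset.sum_congr rfl fun x _ => ?_
    exact integral_indicator_one (hmeas x)
  have hEX2 : μ[X ^ 2] = ∑ x ∈ B, ∑ y ∈ B, μ.real (percolatesAt x ∩ percolatesAt y) := by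
    have hsq : X ^ 2 = fun ω => ∑ x ∈ B, ∑ y ∈ B,
        (percolatesAt x ∩ percolatesAt y).indicator (1 : BondConfig V → ℝ) ω := by
      funext ω
      simp only [Pi.pow_apply, hX, sq, Finset.sum_mul, Finset.mul_sum]
      refine Finset.sum_congr rfl fun x _ => Finset.sum_congr rfl fun y _ => ?_
      simp only [Set.indicator_apply, Set.mem_inter_iff, Pi.one_apply]
      by_cases hx : ω ∈ percolatesAt x <;> by_cases hy : ω ∈ percolatesAt y <;> simp [hx, hy]
    have hint : ∀ x y : V, Integrable
        (fun ω : BondConfig V => (percolatesAt x ∩ percolatesAt y).indicator (1 : BondConfig V → ℝ) ω) μ :=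
      fun x y => (integrable_const (1 : ℝ)).indicator ((hmeas x).inter (hmeas y))
    rw [hsq, integral_finsetSum B fun x _ => integrable_finsetSum B fun y _ => hint x y]
    refine Finset.sum_congr rfl fun x _ => ?_
    rw [integral_finsetSum B fun y _ => hint x y]
    refine Finset.sum_congr rfl fun y _ => ?_
    exact integral_indicator_one ((hmeas x).inter (hmeas y))
  have hvar := variance_nonneg X μ
  rw [variance_eq_sub hLp, hEX, hEX2] at hvar
  linarith

/-! ### Translation invariance and the density bound on `ℤ^d` -/

section Lattice

variable {d : ℕ}

/-- Under translation invariance, `μ[x ↔ ∞] = μ[0 ↔ ∞]` (Aizenman–Duminil-Copin–Sidoravicius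
2015, Thm. 2.3 (R2), used in the proof of Thm. 3.1: `𝔼[X] = |B| ℙ[0 ↔ ∞]`). [cite: AizenmanDuminilCopinSidoraviciusCMP2015, proof of Thm. 3.1] -/
theorem measureReal_percolatesAt_eq_of_invariant (μ : Measure (BondConfig (LatticeModels.Site d)))
    (hT : ∀ v : LatticeModels.Site d, MeasurePreserving (BondConfig.relabel (sym2Equiv (LatticeModels.Site.shift v))) μ μ)
    (x : LatticeModels.Site d) : μ.real (percolatesAt x) = μ.real (percolatesAt 0) := by
  have hpre : BondConfig.relabel (sym2Equiv (LatticeModels.Site.shift x)) ⁻¹' percolatesAt x =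
      (percolatesAt 0 : Set (BondConfig (LatticeModels.Site d))) := by
    ext ω
    simp only [Set.mem_preimage]
    have h := relabel_mem_percolatesAt_iff (LatticeModels.Site.shift x) ω 0
    have h0 : LatticeModels.Site.shift x 0 = x := by simp [LatticeModels.Site.shift_apply]
    rw [h0] at h
    exact h
  rw [measureReal_def, measureReal_def, ← hpre,
    (hT x).measure_preimage (measurableSet_percolatesAt_holds x).nullMeasurableSet]

/-- **The density bound** (Aizenman–Duminil-Copin–Sidoravicius 2015, proof of Thm. 3.1,
(3.4)–(3.5), the percolation part): for a translation-invariant probability measure on bond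
configurations of `ℤ^d` with almost surely at most one infinite cluster and every nonempty finite
`B`, `μ[0 ↔ ∞]² ≤ |B|⁻² ∑_{x,y∈B} μ[x ↔ y]`. [cite: AizenmanDuminilCopinSidoraviciusCMP2015, proof of Thm. 3.1, eqs. (3.4)–(3.5)] -/
theorem sq_measureReal_percolatesAt_le (μ : Measure (BondConfig (LatticeModels.Site d))) [IsProbabilityMeasure μ]
    (hT : ∀ v : LatticeModels.Site d, MeasurePreserving (BondConfig.relabel (sym2Equiv (LatticeModels.Site.shift v))) μ μ)
    (huniq : ∀ᵐ ω ∂μ, numInfiniteClusters ω ≤ 1) {B : Finset (LatticeModels.Site d)} (hB : B.Nonempty) :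
    μ.real (percolatesAt 0) ^ 2 ≤
      (∑ x ∈ B, ∑ y ∈ B, μ.real (openConn x y)) / (B.card : ℝ) ^ 2 := by
  have hcard : (0 : ℝ) < B.card := by exact_mod_cast hB.card_pos
  have h1 := sq_sum_measureReal_percolatesAt_le μ B
  simp_rw [measureReal_percolatesAt_eq_of_invariant μ hT] at h1
  rw [Finset.sum_const, nsmul_eq_mul, mul_pow] at h1
  have h2 : ∑ x ∈ B, ∑ y ∈ B, μ.real (percolatesAt x ∩ percolatesAt y) ≤
      ∑ x ∈ B, ∑ y ∈ B, μ.real (openConn x y) :=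
    Finset.sum_le_sum fun x _ => Finset.sum_le_sum fun y _ => measureReal_percolatesAt_inter_le μ huniq x y
  rw [le_div_iff₀ (by positivity)]
  linarith

/-- **ADS15 Thm. 3.1, abstract form**: if moreover `μ[x ↔ y] ≤ τ(x, y)` for all `x, y` (for the
ADS double current, `τ = ⟨σ_xσ_y⟩⁰_β`, eq. (3.3)), then
`μ[0 ↔ ∞]² ≤ |B|⁻² ∑_{x,y∈B} τ(x,y)` for every nonempty finite `B`; in particular `μ[0 ↔ ∞] = 0`
as soon as the right side has infimum `0` over `B` (`M̃_LRO = 0`). [cite: AizenmanDuminilCopinSidoraviciusCMP2015, Thm. 3.1 and eq. (3.5)] -/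
theorem sq_measureReal_percolatesAt_le_of_le (μ : Measure (BondConfig (LatticeModels.Site d))) [IsProbabilityMeasure μ]
    (hT : ∀ v : LatticeModels.Site d, MeasurePreserving (BondConfig.relabel (sym2Equiv (LatticeModels.Site.shift v))) μ μ)
    (huniq : ∀ᵐ ω ∂μ, numInfiniteClusters ω ≤ 1) (τ : LatticeModels.Site d → LatticeModels.Site d → ℝ)
    (hτ : ∀ x y, μ.real (openConn x y) ≤ τ x y) {B : Finset (LatticeModels.Site d)} (hB : B.Nonempty) :
    μ.real (percolatesAt 0) ^ 2 ≤ (∑ x ∈ B, ∑ y ∈ B, τ x y) / (B.card : ℝ) ^ 2 := by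
  refine (sq_measureReal_percolatesAt_le μ hT huniq hB).trans ?_
  exact div_le_div_of_nonneg_right
    (Finset.sum_le_sum fun x _ => Finset.sum_le_sum fun y _ => hτ x y) (by positivity)

/-- Corollary: if the averages `|B|⁻² ∑_{x,y∈B} τ(x,y)` can be made arbitrarily small then there is
no percolation, `μ[x ↔ ∞] = 0` for every `x` (Aizenman–Duminil-Copin–Sidoravicius 2015, Thm. 3.1:
"For `β` at which `M̃_LRO(β) = 0`, also `ℙ_β[0 ↔ ∞] = 0`"). [cite: AizenmanDuminilCopinSidoraviciusCMP2015, Thm. 3.1] -/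
theorem measure_percolatesAt_eq_zero_of_forall_exists (μ : Measure (BondConfig (LatticeModels.Site d)))
    [IsProbabilityMeasure μ]
    (hT : ∀ v : LatticeModels.Site d, MeasurePreserving (BondConfig.relabel (sym2Equiv (LatticeModels.Site.shift v))) μ μ)
    (huniq : ∀ᵐ ω ∂μ, numInfiniteClusters ω ≤ 1) (τ : LatticeModels.Site d → LatticeModels.Site d → ℝ)
    (hτ : ∀ x y, μ.real (openConn x y) ≤ τ x y)
    (hinf : ∀ ε : ℝ, 0 < ε → ∃ B : Finset (LatticeModels.Site d), B.Nonempty ∧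
      (∑ x ∈ B, ∑ y ∈ B, τ x y) / (B.card : ℝ) ^ 2 < ε) (x : LatticeModels.Site d) :
    μ (percolatesAt x) = 0 := by
  have hθ : μ.real (percolatesAt 0) = 0 := by
    by_contra hne
    have hpos : 0 < μ.real (percolatesAt 0) ^ 2 := by positivity
    obtain ⟨B, hB, hlt⟩ := hinf _ hpos
    exact absurd (sq_measureReal_percolatesAt_le_of_le μ hT huniq τ hτ hB) (not_le.2 hlt)
  rw [← measureReal_eq_zero_iff (measure_ne_top _ _), measureReal_percolatesAt_eq_of_invariant μ hT x]
  exact hθ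

end Lattice

/-! ### Without ergodicity: at most two infinite clusters suffice, `θ² ≤ 2|B|⁻² ∑ μ[x ↔ y]` -/

section TwoClusters

variable {V : Type*}

/-- **Combinatorial core**: if no three percolating sites are pairwise disconnected (at most two
infinite clusters) then, for every finite `B`, the number of ordered connected pairs of `B` is at
least half the square of the number of percolating sites of `B`:
`#{x ∈ B : x ↔ ∞}² ≤ 2 #{(x,y) ∈ B² : x ↔ y}` — the percolating sites split into at most two
classes of mutually connected sites, and `(a+b)² ≤ 2(a² + b²)`. [folklore] -/
theorem card_filter_percolatesAt_sq_le [DecidableEq V] {ω : BondConfig V} (hω : ω ∉ threeInfClusters V)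
    (B : Finset V) [DecidablePred fun x => ω ∈ (percolatesAt x : Set (BondConfig V))]
    [DecidableRel (openGraph ω).Reachable] :
    ((B.filter fun x => ω ∈ (percolatesAt x : Set (BondConfig V))).card : ℝ) ^ 2 ≤
      2 * ∑ x ∈ B, ∑ y ∈ B, (if (openGraph ω).Reachable x y then (1 : ℝ) else 0) := by
  set P := B.filter fun x => ω ∈ (percolatesAt x : Set (BondConfig V)) with hP
  rcases P.eq_empty_or_nonempty with hPe | ⟨x₀, hx₀⟩
  · rw [hPe, Finset.card_empty, Nat.cast_zero, zero_pow two_ne_zero]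
    exact mul_nonneg zero_le_two
      (Finset.sum_nonneg fun x _ => Finset.sum_nonneg fun y _ => by split_ifs <;> norm_num)
  -- the two classes
  set A := P.filter fun y => (openGraph ω).Reachable x₀ y with hA
  set A' := P.filter fun y => ¬ (openGraph ω).Reachable x₀ y with hA'
  have hPcard : (P.card : ℝ) = A.card + A'.card := by
    have := Finset.card_filter_add_card_filter_not (s := P) (fun y => (openGraph ω).Reachable x₀ y)
    rw [← hA, ← hA'] at this
    exact_mod_cast this.symm
  have hPmem : ∀ {y}, y ∈ P → y ∈ B ∧ ω ∈ (percolatesAt y : Set (BondConfig V)) := fun hy =>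
    Finset.mem_filter.1 hy
  -- pairs inside `A` are connected (through `x₀`), pairs inside `A'` are connected (no third cluster)
  have hAA : ∀ x ∈ A, ∀ y ∈ A, (openGraph ω).Reachable x y := by
    intro x hx y hy
    exact ((Finset.mem_filter.1 hx).2.symm).trans (Finset.mem_filter.1 hy).2
  have hA'A' : ∀ x ∈ A', ∀ y ∈ A', (openGraph ω).Reachable x y := by
    intro x hx y hy
    obtain ⟨hxP, hx0⟩ := Finset.mem_filter.1 hx
    obtain ⟨hyP, hy0⟩ := Finset.mem_filter.1 hy
    by_contra hxy
    exact hω ⟨x₀, x, y, (hPmem hx₀).2, (hPmem hxP).2, (hPmem hyP).2, hx0, hy0, hxy⟩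
  -- count
  have hAB : A ⊆ B := fun y hy => (hPmem (Finset.mem_filter.1 hy).1).1
  have hA'B : A' ⊆ B := fun y hy => (hPmem (Finset.mem_filter.1 hy).1).1
  have hdisj : Disjoint A A' := Finset.disjoint_filter_filter_not P P _
  have hcount : (A.card : ℝ) ^ 2 + (A'.card : ℝ) ^ 2 ≤
      ∑ x ∈ B, ∑ y ∈ B, (if (openGraph ω).Reachable x y then (1 : ℝ) else 0) := by
    have hnn : ∀ x y, 0 ≤ (if (openGraph ω).Reachable x y then (1 : ℝ) else 0) := fun x y => by
      split_ifs <;> norm_num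
    calc (A.card : ℝ) ^ 2 + (A'.card : ℝ) ^ 2
        = (∑ x ∈ A, ∑ y ∈ A, (if (openGraph ω).Reachable x y then (1 : ℝ) else 0)) +
            ∑ x ∈ A', ∑ y ∈ A', (if (openGraph ω).Reachable x y then (1 : ℝ) else 0) := by
          rw [Finset.sum_congr rfl fun x hx => Finset.sum_congr rfl fun y hy => if_pos (hAA x hx y hy),
            Finset.sum_congr rfl fun x hx => Finset.sum_congr rfl fun y hy => if_pos (hA'A' x hx y hy)]
          simp only [Finset.sum_const, nsmul_eq_mul, mul_one, sq]
      _ ≤ (∑ x ∈ A, ∑ y ∈ B, (if (openGraph ω).Reachable x y then (1 : ℝ) else 0)) +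
            ∑ x ∈ A', ∑ y ∈ B, (if (openGraph ω).Reachable x y then (1 : ℝ) else 0) := by
          exact add_le_add
            (Finset.sum_le_sum fun x _ => Finset.sum_le_sum_of_subset_of_nonneg hAB fun y _ _ => hnn x y)
            (Finset.sum_le_sum fun x _ => Finset.sum_le_sum_of_subset_of_nonneg hA'B fun y _ _ => hnn x y)
      _ = ∑ x ∈ A ∪ A', ∑ y ∈ B, (if (openGraph ω).Reachable x y then (1 : ℝ) else 0) :=
          (Finset.sum_union hdisj).symm
      _ ≤ ∑ x ∈ B, ∑ y ∈ B, (if (openGraph ω).Reachable x y then (1 : ℝ) else 0) :=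
          Finset.sum_le_sum_of_subset_of_nonneg (Finset.union_subset hAB hA'B)
            fun x _ _ => Finset.sum_nonneg fun y _ => hnn x y
  rw [hPcard]
  nlinarith [sq_nonneg ((A.card : ℝ) - A'.card)]

/-- **Second-moment bound without uniqueness**: if `μ`-a.s. there are at most two infinite
clusters then `(∑_{x∈B} μ[x ↔ ∞])² ≤ 2 ∑_{x,y∈B} μ[x ↔ y]` — Cauchy–Schwarz as in
`sq_sum_measureReal_percolatesAt_le`, followed by the pointwise `card_filter_percolatesAt_sq_le`.
This variant needs no zero–one law (no ergodicity) for the measure, only the "no three infinite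
clusters" half of Burton–Keane, which uses translation invariance and insertion tolerance alone
(`measure_threeInfClusters_eq_zero_of_invariant`). [folklore] -/
theorem sq_sum_measureReal_percolatesAt_le_two_mul [Countable V] (μ : Measure (BondConfig V))
    [IsProbabilityMeasure μ] (h3 : μ (threeInfClusters V) = 0) (B : Finset V) :
    (∑ x ∈ B, μ.real (percolatesAt x)) ^ 2 ≤ 2 * ∑ x ∈ B, ∑ y ∈ B, μ.real (openConn x y) := by
  classical
  have hmeas : ∀ x : V, MeasurableSet (percolatesAt x : Set (BondConfig V)) := fun x =>
    measurableSet_percolatesAt_holds x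
  have hmeasC : ∀ x y : V, MeasurableSet (openConn x y : Set (BondConfig V)) := fun x y =>
    measurableSet_openConn_holds x y
  refine (sq_sum_measureReal_percolatesAt_le μ B).trans ?_
  -- integrate the pointwise inequality
  have hL : ∑ x ∈ B, ∑ y ∈ B, μ.real (percolatesAt x ∩ percolatesAt y) =
      ∫ ω, ∑ x ∈ B, ∑ y ∈ B, (percolatesAt x ∩ percolatesAt y).indicator (1 : BondConfig V → ℝ) ω ∂μ := by
    have hint : ∀ x y : V, Integrable
        (fun ω : BondConfig V => (percolatesAt x ∩ percolatesAt y).indicator (1 : BondConfig V → ℝ) ω) μ :=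
      fun x y => (integrable_const (1 : ℝ)).indicator ((hmeas x).inter (hmeas y))
    rw [integral_finsetSum B fun x _ => integrable_finsetSum B fun y _ => hint x y]
    refine Finset.sum_congr rfl fun x _ => ?_
    rw [integral_finsetSum B fun y _ => hint x y]
    refine Finset.sum_congr rfl fun y _ => ?_
    exact (integral_indicator_one ((hmeas x).inter (hmeas y))).symm
  have hR : 2 * ∑ x ∈ B, ∑ y ∈ B, μ.real (openConn x y) =
      ∫ ω, 2 * ∑ x ∈ B, ∑ y ∈ B, (openConn x y).indicator (1 : BondConfig V → ℝ) ω ∂μ := by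
    have hint : ∀ x y : V, Integrable
        (fun ω : BondConfig V => (openConn x y).indicator (1 : BondConfig V → ℝ) ω) μ :=
      fun x y => (integrable_const (1 : ℝ)).indicator (hmeasC x y)
    rw [integral_const_mul, integral_finsetSum B fun x _ => integrable_finsetSum B fun y _ => hint x y]
    congr 1
    refine Finset.sum_congr rfl fun x _ => ?_
    rw [integral_finsetSum B fun y _ => hint x y]
    refine Finset.sum_congr rfl fun y _ => ?_
    exact (integral_indicator_one (hmeasC x y)).symm
  rw [hL, hR]
  refine integral_mono_ae (integrable_finsetSum B fun x _ => integrable_finsetSum B fun y _ =>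
      (integrable_const (1 : ℝ)).indicator ((hmeas x).inter (hmeas y)))
    ((integrable_finsetSum B fun x _ => integrable_finsetSum B fun y _ =>
      (integrable_const (1 : ℝ)).indicator (hmeasC x y)).const_mul 2) ?_
  have hae : ∀ᵐ ω ∂μ, ω ∉ threeInfClusters V := by
    rw [ae_iff]; simpa using h3
  filter_upwards [hae] with ω hω
  -- pointwise: `X(ω)² ≤ 2 · #connected pairs`
  have hX : ∑ x ∈ B, ∑ y ∈ B, (percolatesAt x ∩ percolatesAt y).indicator (1 : BondConfig V → ℝ) ω =
      ((B.filter fun x => ω ∈ (percolatesAt x : Set (BondConfig V))).card : ℝ) ^ 2 := by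
    have h1 : ∀ x y, (percolatesAt x ∩ percolatesAt y).indicator (1 : BondConfig V → ℝ) ω =
        (if ω ∈ (percolatesAt x : Set (BondConfig V)) then (1 : ℝ) else 0) *
          (if ω ∈ (percolatesAt y : Set (BondConfig V)) then (1 : ℝ) else 0) := by
      intro x y
      simp only [Set.indicator_apply, Set.mem_inter_iff, Pi.one_apply]
      by_cases hx : ω ∈ percolatesAt x <;> by_cases hy : ω ∈ percolatesAt y <;> simp [hx, hy]
    simp_rw [h1, ← Finset.mul_sum, ← Finset.sum_mul]
    rw [Finset.sum_boole, sq]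
  have hC : ∑ x ∈ B, ∑ y ∈ B, (openConn x y).indicator (1 : BondConfig V → ℝ) ω =
      ∑ x ∈ B, ∑ y ∈ B, (if (openGraph ω).Reachable x y then (1 : ℝ) else 0) := by
    refine Finset.sum_congr rfl fun x _ => Finset.sum_congr rfl fun y _ => ?_
    simp [Set.indicator_apply, openConn]
  rw [hX, hC]
  exact card_filter_percolatesAt_sq_le hω B

end TwoClusters

section LatticeTwo

variable {d : ℕ}

/-- **The density bound without ergodicity** (the observation that makes the zero–one law for the
limiting measure unnecessary in Aizenman–Duminil-Copin–Sidoravicius 2015, proof of Thm. 3.1): for a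
translation-invariant probability measure on bond configurations of `ℤ^d` with almost surely at
most two infinite clusters, `μ[0 ↔ ∞]² ≤ 2|B|⁻² ∑_{x,y∈B} μ[x ↔ y]` for every nonempty finite
`B`. [cite: AizenmanDuminilCopinSidoraviciusCMP2015, proof of Thm. 3.1, eqs. (3.4)–(3.5)] -/
theorem sq_measureReal_percolatesAt_le_two_mul (μ : Measure (BondConfig (LatticeModels.Site d)))
    [IsProbabilityMeasure μ]
    (hT : ∀ v : LatticeModels.Site d, MeasurePreserving (BondConfig.relabel (sym2Equiv (LatticeModels.Site.shift v))) μ μ)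
    (h3 : μ (threeInfClusters (LatticeModels.Site d)) = 0) {B : Finset (LatticeModels.Site d)} (hB : B.Nonempty) :
    μ.real (percolatesAt 0) ^ 2 ≤
      2 * (∑ x ∈ B, ∑ y ∈ B, μ.real (openConn x y)) / (B.card : ℝ) ^ 2 := by
  have hcard : (0 : ℝ) < B.card := by exact_mod_cast hB.card_pos
  have h1 := sq_sum_measureReal_percolatesAt_le_two_mul μ h3 B
  simp_rw [measureReal_percolatesAt_eq_of_invariant μ hT] at h1
  rw [Finset.sum_const, nsmul_eq_mul, mul_pow] at h1
  rw [le_div_iff₀ (by positivity)]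
  linarith

/-- **No percolation from `M̃_LRO = 0` without ergodicity**: if `μ` is translation invariant with
a.s. at most two infinite clusters, `μ[x ↔ y] ≤ τ(x,y)`, and the averages `|B|⁻² ∑_{x,y∈B} τ(x,y)`
can be made arbitrarily small, then `μ[x ↔ ∞] = 0` for every `x`
(Aizenman–Duminil-Copin–Sidoravicius 2015, Thm. 3.1, with Thm. 2.5 weakened to "no three infinite
clusters", which by `measure_threeInfClusters_eq_zero_of_invariant` needs only translation
invariance and insertion tolerance — not the ergodicity (R3) of Thm. 2.3). [cite: AizenmanDuminilCopinSidoraviciusCMP2015, Thm. 3.1] -/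
theorem measure_percolatesAt_eq_zero_of_forall_exists' (μ : Measure (BondConfig (LatticeModels.Site d)))
    [IsProbabilityMeasure μ]
    (hT : ∀ v : LatticeModels.Site d, MeasurePreserving (BondConfig.relabel (sym2Equiv (LatticeModels.Site.shift v))) μ μ)
    (h3 : μ (threeInfClusters (LatticeModels.Site d)) = 0) (τ : LatticeModels.Site d → LatticeModels.Site d → ℝ)
    (hτ : ∀ x y, μ.real (openConn x y) ≤ τ x y)
    (hinf : ∀ ε : ℝ, 0 < ε → ∃ B : Finset (LatticeModels.Site d), B.Nonempty ∧
      (∑ x ∈ B, ∑ y ∈ B, τ x y) / (B.card : ℝ) ^ 2 < ε) (x : LatticeModels.Site d) :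
    μ (percolatesAt x) = 0 := by
  have hθ : μ.real (percolatesAt 0) = 0 := by
    by_contra hne
    have hpos : 0 < μ.real (percolatesAt 0) ^ 2 / 2 := by positivity
    obtain ⟨B, hB, hlt⟩ := hinf _ hpos
    have h := sq_measureReal_percolatesAt_le_two_mul μ hT h3 hB
    have hτsum : ∑ x ∈ B, ∑ y ∈ B, μ.real (openConn x y) ≤ ∑ x ∈ B, ∑ y ∈ B, τ x y :=
      Finset.sum_le_sum fun x _ => Finset.sum_le_sum fun y _ => hτ x y
    have hcard : (0 : ℝ) < (B.card : ℝ) ^ 2 := by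
      have : (0 : ℝ) < B.card := by exact_mod_cast hB.card_pos
      positivity
    have h' : μ.real (percolatesAt 0) ^ 2 ≤ 2 * (∑ x ∈ B, ∑ y ∈ B, τ x y) / (B.card : ℝ) ^ 2 :=
      h.trans (div_le_div_of_nonneg_right (by linarith) hcard.le)
    rw [mul_div_assoc] at h'
    linarith
  rw [← measureReal_eq_zero_iff (measure_ne_top _ _), measureReal_percolatesAt_eq_of_invariant μ hT x]
  exact hθ

end LatticeTwo

/-! ### The half of Burton–Keane that needs no ergodicity, and the resulting criterion -/

section NoErgodicity

variable {d : ℕ}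

/-- Translation invariance carries the cut-ball probability from `0` to any centre:
`μ(T_r(0)) ≤ μ(T_r(c))` (Bollobás–Riordan 2006, Ch. 5, (2), p. 107, for a translation-invariant
measure). [cite: BollobasRiordan2006, Ch. 5, proof of Thm. 4 ((2), p. 107)] -/
theorem real_cutBall_zero_le_of_invariant (μ : Measure (BondConfig (LatticeModels.Site d))) [IsFiniteMeasure μ]
    (hT : ∀ v : LatticeModels.Site d, MeasurePreserving (BondConfig.relabel (sym2Equiv (LatticeModels.Site.shift v))) μ μ)
    (c : LatticeModels.Site d) (r : ℕ) : μ.real (cutBall 0 r) ≤ μ.real (cutBall c r) := by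
  have h := (hT c).measure_preimage (measurableSet_cutBall c r).nullMeasurableSet
  have h' : μ.real (BondConfig.relabel (sym2Equiv (LatticeModels.Site.shift c)) ⁻¹' cutBall c r) =
      μ.real (cutBall c r) := by
    rw [measureReal_def, measureReal_def, h]
  rw [← h']
  exact measureReal_mono (by simpa using cutBall_subset_preimage_shift (0 : LatticeModels.Site d) c r)

/-- The expected number of cut-balls among the centres is at most `|∂ⁱⁿΛ_{n+1}|`, for any measure
carried by nearest-neighbour configurations (Bollobás–Riordan 2006, Ch. 5, p. 108). [cite: BollobasRiordan2006, Ch. 5, proof of Thm. 4 (p. 108)] -/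
theorem sum_measure_cutBall_le_of_ae_subset (μ : Measure (BondConfig (LatticeModels.Site d))) [IsProbabilityMeasure μ]
    (hS : ∀ᵐ ω ∂μ, ω ⊆ (LatticeModels.zdGraph d).edgeSet) (r m : ℕ) :
    ∑ c ∈ centres r m, μ (cutBall c r) ≤
      (LatticeModels.innerBoundary (LatticeModels.zdGraph d) (LatticeModels.box d ((2 * r + 2) * m + r + 1))).card := by
  classical
  set L := LatticeModels.innerBoundary (LatticeModels.zdGraph d) (LatticeModels.box d ((2 * r + 2) * m + r + 1)) with hL
  have h1 : ∑ c ∈ centres r m, μ (cutBall c r) =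
      ∫⁻ ω, ∑ c ∈ centres r m, (cutBall c r).indicator 1 ω ∂μ := by
    rw [lintegral_finsetSum _ fun c _ => measurable_one.indicator (measurableSet_cutBall c r)]
    exact Finset.sum_congr rfl fun c _ => (lintegral_indicator_one (measurableSet_cutBall c r)).symm
  calc ∑ c ∈ centres r m, μ (cutBall c r)
        = ∫⁻ ω, ∑ c ∈ centres r m, (cutBall c r).indicator 1 ω ∂μ := h1
    _ ≤ ∫⁻ _ω, (L.card : ℝ≥0∞) ∂μ := by
        refine lintegral_mono_ae ?_
        filter_upwards [hS] with ω hω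
        have hsum : ∑ c ∈ centres r m, (cutBall c r).indicator (1 : BondConfig (LatticeModels.Site d) → ℝ≥0∞) ω =
            (((centres r m).filter fun c => ω ∈ cutBall c r).card : ℝ≥0∞) := by
          simp only [Set.indicator_apply, Pi.one_apply]
          rw [Finset.sum_boole]
        rw [hsum]
        exact_mod_cast card_filter_cutBall_le r m hω
    _ = L.card := by rw [lintegral_const, measure_univ, mul_one]

/-- **`μ(`at least three infinite clusters`) = 0` without ergodicity** — for a probability
measure on bond configurations of `ℤ^d`, `d ≥ 1`, carried by nearest-neighbour configurations,
translation invariant and box insertion tolerant (Bollobás–Riordan 2006, Ch. 5, Thm. 4 and its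
proof, pp. 107–109, which uses nothing else; Burton–Keane 1989). This is the tree's
`IsInsertionTolerantErgodic.threeInfClusters_eq_zero` (`UniquenessInsertionTolerant.lean`, same
proof), restated with the three hypotheses that proof actually uses — its structure also demands
the zero–one law for invariant events, which is exactly what the two-cluster density bound lets
one avoid. If not, some `Λ_r` meets three infinite
clusters with positive probability; opening `Λ_r` makes it a cut-ball, so `a = μ(T_r(0)) > 0`
(insertion tolerance) and `μ(T_r(c)) ≥ a` at every centre (translation invariance); the expected
number of cut-balls among `(2m+1)^d` disjoint translates in `Λ_n` is `≥ a(2m+1)^d` but at most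
`|∂ⁱⁿΛ_{n+1}| = O((2m+1)^{d-1})`. [cite: BollobasRiordan2006, Ch. 5, Thm. 4 (pp. 107–109)] -/
theorem measure_threeInfClusters_eq_zero_of_invariant (hd : 1 ≤ d)
    (μ : Measure (BondConfig (LatticeModels.Site d))) [IsProbabilityMeasure μ]
    (hS : ∀ᵐ ω ∂μ, ω ⊆ (LatticeModels.zdGraph d).edgeSet)
    (hT : ∀ v : LatticeModels.Site d, MeasurePreserving (BondConfig.relabel (sym2Equiv (LatticeModels.Site.shift v))) μ μ)
    (hI : ∀ n : ℕ, ∃ c : ℝ, 0 < c ∧ ∀ E : Set (BondConfig (LatticeModels.Site d)), MeasurableSet E →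
      c * μ.real (openEdges ↑(LatticeModels.edgesIn (LatticeModels.zdGraph d) (LatticeModels.box d n)) ⁻¹' E) ≤ μ.real E) :
    μ (threeInfClusters (LatticeModels.Site d)) = 0 := by
  classical
  by_contra h3
  -- some box meets three infinite clusters with positive probability
  obtain ⟨r, hr⟩ : ∃ r, μ (threeInBox (d := d) r) ≠ 0 := by
    by_contra hall
    push Not at hall
    exact h3 (measure_mono_null threeInfClusters_subset_iUnion (measure_iUnion_null_iff.2 hall))
  -- opening `Λ_r` on this event produces a cut-ball: `a = μ(T_r(0)) > 0`
  set A : Set (BondConfig (LatticeModels.Site d)) := threeInBox r ∩ {ω | ω ⊆ (LatticeModels.zdGraph d).edgeSet} with hA_def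
  have hAE : μ {ω : BondConfig (LatticeModels.Site d) | ω ⊆ (LatticeModels.zdGraph d).edgeSet}ᶜ = 0 := by
    rw [Set.compl_setOf]
    exact ae_iff.1 hS
  have hA : 0 < μ.real A := by
    rw [measureReal_def, ENNReal.toReal_pos_iff]
    refine ⟨pos_iff_ne_zero.2 ?_, measure_lt_top _ _⟩
    rwa [hA_def, measure_inter_conull hAE]
  have hAT : ∀ ω ∈ A, openEdges ↑(LatticeModels.edgesIn (LatticeModels.zdGraph d) (LatticeModels.box d r)) ω ∈ cutBall (0 : LatticeModels.Site d) r := by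
    rintro ω ⟨⟨x, hxbox, hperc, hdis⟩, hωG⟩
    change IsCutSet (LatticeModels.zdGraph d) (shiftedBox 0 r) _
    rw [shiftedBox_zero]
    exact isCutSet_openEdges_of_three hωG hxbox hperc hdis
  have ha : 0 < μ.real (cutBall (0 : LatticeModels.Site d) r) := by
    obtain ⟨c, hc, hcE⟩ := hI r
    have h1 : μ.real A ≤ μ.real (openEdges ↑(LatticeModels.edgesIn (LatticeModels.zdGraph d) (LatticeModels.box d r)) ⁻¹' cutBall (0 : LatticeModels.Site d) r) :=
      measureReal_mono fun ω hω => hAT ω hω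
    have h2 := hcE _ (measurableSet_cutBall 0 r)
    nlinarith [mul_pos hc (hA.trans_le h1)]
  set a := μ.real (cutBall (0 : LatticeModels.Site d) r) with ha_def
  -- choose the number of translates
  set C₀ : ℕ := 2 * d * (2 * r + 3) ^ (d - 1) with hC₀
  obtain ⟨m, hm⟩ := exists_nat_gt ((C₀ : ℝ) / a)
  have hm' : (C₀ : ℝ) < a * (2 * m + 1) := by
    rw [div_lt_iff₀ ha] at hm
    nlinarith
  set n := (2 * r + 2) * m + r with hn
  set L := LatticeModels.innerBoundary (LatticeModels.zdGraph d) (LatticeModels.box d (n + 1)) with hL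
  -- lower bound for the expected number of cut-balls
  have hlow : ((2 * m + 1 : ℝ)) ^ d * a ≤ ∑ c ∈ centres r m, μ.real (cutBall c r) := by
    calc ((2 * m + 1 : ℝ)) ^ d * a = ∑ _c ∈ centres (d := d) r m, a := by
          rw [Finset.sum_const, card_centres, nsmul_eq_mul]; push_cast; ring
      _ ≤ ∑ c ∈ centres r m, μ.real (cutBall c r) :=
          Finset.sum_le_sum fun c _ => real_cutBall_zero_le_of_invariant μ hT c r
  -- upper bound
  have hup : ∑ c ∈ centres r m, μ.real (cutBall c r) ≤ (L.card : ℝ) := by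
    have h := sum_measure_cutBall_le_of_ae_subset (d := d) μ hS r m
    have hsum : ∑ c ∈ centres r m, μ.real (cutBall c r) =
        (∑ c ∈ centres r m, μ (cutBall c r)).toReal := by
      rw [ENNReal.toReal_sum fun c _ => measure_ne_top _ _]
      rfl
    rw [hsum]
    have := ENNReal.toReal_mono (ENNReal.natCast_ne_top L.card) h
    simpa using this
  -- the boundary is small
  have hLcard : (L.card : ℝ) ≤ C₀ * (2 * m + 1 : ℝ) ^ (d - 1) := by
    have h1 := card_innerBoundary_box_le (d := d) (n + 1)
    have h2 : 2 * (n + 1) + 1 ≤ (2 * r + 3) * (2 * m + 1) := by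
      have : (2 * r + 3) * (2 * m + 1) = 2 * (n + 1) + 1 + 2 * m := by rw [hn]; ring
      omega
    calc (L.card : ℝ) ≤ ((2 * d * (2 * (n + 1) + 1) ^ (d - 1) : ℕ) : ℝ) := by exact_mod_cast h1
      _ ≤ ((2 * d * ((2 * r + 3) * (2 * m + 1)) ^ (d - 1) : ℕ) : ℝ) := by
          exact_mod_cast Nat.mul_le_mul_left _ (Nat.pow_le_pow_left h2 _)
      _ = C₀ * (2 * m + 1 : ℝ) ^ (d - 1) := by rw [hC₀]; push_cast; rw [mul_pow]; ring
  -- combine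
  have hpow : (2 * m + 1 : ℝ) ^ d = (2 * m + 1) * (2 * m + 1) ^ (d - 1) := by
    conv_lhs => rw [← Nat.sub_add_cancel hd, pow_succ]
    ring
  have hchain := hlow.trans (hup.trans hLcard)
  rw [hpow] at hchain
  have hpos : (0 : ℝ) < (2 * m + 1) ^ (d - 1) := by positivity
  have key : (2 * m + 1 : ℝ) * a ≤ C₀ := by
    have h' : ((2 * m + 1 : ℝ) * a) * (2 * m + 1) ^ (d - 1) ≤ (C₀ : ℝ) * (2 * m + 1) ^ (d - 1) := by
      linarith [hchain]
    exact le_of_mul_le_mul_right h' hpos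
  linarith [key, hm']


/-- **No percolation from `M̃_LRO = 0` for translation-invariant insertion-tolerant laws** — the
one-stop form for Aizenman–Duminil-Copin–Sidoravicius 2015, Thm. 3.1 with Lemma 2.6 and the
translation invariance R2, *without* the ergodicity R3: if `μ` is a probability measure on bond
configurations of `ℤ^d` (`d ≥ 1`) carried by nearest-neighbour configurations, invariant under
translations and box insertion tolerant, and `μ[x ↔ y] ≤ τ(x,y)` with
`inf_B |B|⁻² ∑_{x,y∈B} τ(x,y) = 0`, then `μ[x ↔ ∞] = 0` for every `x`. [cite: AizenmanDuminilCopinSidoraviciusCMP2015, Thm. 3.1 with Thm. 2.5 and Lemma 2.6] -/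
theorem measure_percolatesAt_eq_zero_of_insertionTolerant (hd : 1 ≤ d)
    (μ : Measure (BondConfig (LatticeModels.Site d))) [IsProbabilityMeasure μ]
    (hS : ∀ᵐ ω ∂μ, ω ⊆ (LatticeModels.zdGraph d).edgeSet)
    (hT : ∀ v : LatticeModels.Site d, MeasurePreserving (BondConfig.relabel (sym2Equiv (LatticeModels.Site.shift v))) μ μ)
    (hI : ∀ n : ℕ, ∃ c : ℝ, 0 < c ∧ ∀ E : Set (BondConfig (LatticeModels.Site d)), MeasurableSet E →
      c * μ.real (openEdges ↑(LatticeModels.edgesIn (LatticeModels.zdGraph d) (LatticeModels.box d n)) ⁻¹' E) ≤ μ.real E)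
    (τ : LatticeModels.Site d → LatticeModels.Site d → ℝ) (hτ : ∀ x y, μ.real (openConn x y) ≤ τ x y)
    (hinf : ∀ ε : ℝ, 0 < ε → ∃ B : Finset (LatticeModels.Site d), B.Nonempty ∧
      (∑ x ∈ B, ∑ y ∈ B, τ x y) / (B.card : ℝ) ^ 2 < ε) (x : LatticeModels.Site d) :
    μ (percolatesAt x) = 0 :=
  measure_percolatesAt_eq_zero_of_forall_exists' μ hT
    (measure_threeInfClusters_eq_zero_of_invariant hd μ hS hT hI) τ hτ hinf x

/-- Translation invariance in the form "`μ(A + v) = μ(A)` for measurable `A`" (as in the tree's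
`IsInsertionTolerantErgodic.measure_preimage_shift`) gives the `MeasurePreserving` form used
above. [folklore] -/
theorem measurePreserving_relabel_shift_of_forall (μ : Measure (BondConfig (LatticeModels.Site d)))
    (h : ∀ (v : LatticeModels.Site d) {S : Set (BondConfig (LatticeModels.Site d))}, MeasurableSet S →
      μ (BondConfig.relabel (sym2Equiv (LatticeModels.Site.shift v)) ⁻¹' S) = μ S) (v : LatticeModels.Site d) :
    MeasurePreserving (BondConfig.relabel (sym2Equiv (LatticeModels.Site.shift v))) μ μ := by
  refine ⟨(BondConfig.relabel (sym2Equiv (LatticeModels.Site.shift v))).measurable, Measure.ext fun S hS => ?_⟩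
  rw [Measure.map_apply (BondConfig.relabel (sym2Equiv (LatticeModels.Site.shift v))).measurable hS]
  exact h v hS

end NoErgodicity

end Literature.Probability.Percolation
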